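import Mathlib
import Summits.Ventures.PercRepro2.HCov
import Summits.Ventures.PercRepro2.GcSkelReductionT
import Summits.Ventures.PercRepro2.GcSkelReductionMin
import Summits.Ventures.PercRepro2.GcSkelReductionO
import Summits.Ventures.PercRepro2.GcSkelReductionOB

/-!
# The class of record with its minimal clause list (blind cell PercRepro2, typer-1 g54)

`WReducedOB` (`GcSkelReductionOB.lean`) is `WReducedT` minus the three star classes of mine-2 g39;
`WReducedMin` (`GcSkelReductionMin.lean`) is the minimal clause list of `WReducedT`. Together:

* **`WReducedMinOB`** := `WReducedMin` ∧ ¬ star of `o` ∧ ¬ star of `b` ∧ ¬ `{a₃, b}`-star of `o` —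
  the class of record in ONE definition of twenty-six finite clauses;
* **`wredOB_iff_wredMinOB`**: `WReducedOB ↔ WReducedMinOB`; **`HCov_all_iff_HCovWRedMinOB_all`**.
-/

namespace Summit.Ventures.PercRepro2

open CovForm RECM

namespace WRed

section ClassMinOB

variable {V : Type*} {E : Type*} [Fintype E] [DecidableEq E] [DecidableEq V]

/-- **The class of record with its minimal clause list**: `WReducedMin` and the three star
clauses. -/
structure WReducedMinOB (ends : E → Sym2 V) (o a₁ a₂ a₃ b : V) : Prop
    extends WReducedMin ends o a₁ a₂ a₃ b where
  /-- not the star class of `o` -/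
  notOStar : ¬ OToMarks ends o a₁ a₂ b
  /-- not the star class of `b` -/
  notBStar : ¬ OToMarks ends b a₁ a₂ o
  /-- not the `{a₃, b}`-star class of `o` -/
  notOA3B : ¬ OTwoToMarks ends o a₃ b

/-- **The class of record is its minimal clause list**: `WReducedOB ↔ WReducedMinOB`. -/
theorem wredOB_iff_wredMinOB {ends : E → Sym2 V} {o a₁ a₂ a₃ b : V} :
    WReducedOB ends o a₁ a₂ a₃ b ↔ WReducedMinOB ends o a₁ a₂ a₃ b :=
  ⟨fun h => ⟨wredMin_of_wredT h.toWReducedT, h.notOStar, h.notBStar, h.notOA3B⟩,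
   fun h => ⟨⟨wredT_of_wredMin h.toWReducedMin, h.notOStar⟩, h.notBStar, h.notOA3B⟩⟩

end ClassMinOB

section Closure

variable (R : Type*) [Field R] [LinearOrder R] [IsStrictOrderedRing R]

/-- **(HCOV) on the class of record, minimal clause list**. -/
def HCovWRedMinOB_all : Prop :=
  ∀ (V E : Type) [Fintype V] [DecidableEq V] [Fintype E] [DecidableEq E]
    (ends : E → Sym2 V) (p : E → R), IsProbVec p →
    ∀ o a₁ a₂ a₃ b : V, a₁ ≠ a₂ → a₁ ≠ a₃ → a₂ ≠ a₃ → o ≠ a₁ → o ≠ a₂ → o ≠ a₃ → o ≠ b →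
      b ≠ a₁ → b ≠ a₂ → b ≠ a₃ → WReducedMinOB ends o a₁ a₂ a₃ b → HCov p ends o a₁ a₂ a₃ b

end Closure

section Main

variable {R : Type*} [Field R] [LinearOrder R] [IsStrictOrderedRing R]

omit [IsStrictOrderedRing R] in
/-- The two closures agree clause for clause. -/
theorem HCovWRedOB_all_iff_HCovWRedMinOB_all : HCovWRedOB_all R ↔ HCovWRedMinOB_all R := by
  constructor
  · intro h V E _ _ _ _ ends p hp o a₁ a₂ a₃ b h12 h13 h23 ho1 ho2 ho3 hob hb1 hb2 hb3 hred
    exact h V E ends p hp o a₁ a₂ a₃ b h12 h13 h23 ho1 ho2 ho3 hob hb1 hb2 hb3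
      (wredOB_iff_wredMinOB.2 hred)
  · intro h V E _ _ _ _ ends p hp o a₁ a₂ a₃ b h12 h13 h23 ho1 ho2 ho3 hob hb1 hb2 hb3 hred
    exact h V E ends p hp o a₁ a₂ a₃ b h12 h13 h23 ho1 ho2 ho3 hob hb1 hb2 hb3
      (wredOB_iff_wredMinOB.1 hred)

/-- **THE CRUX ON THE CLASS OF RECORD, MINIMAL CLAUSE LIST**: `HCov_all ↔ HCovWRedMinOB_all`. -/
theorem HCov_all_iff_HCovWRedMinOB_all : HCov_all R ↔ HCovWRedMinOB_all R :=
  HCov_all_iff_HCovWRedOB_all.trans HCovWRedOB_all_iff_HCovWRedMinOB_all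

end Main

end WRed

end Summit.Ventures.PercRepro2
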